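import Summits.QuantumFields.BalabanUV.Beta.LagrangeFoldLiteral

/-!
# `BalabanUV.Beta.LagrangeFoldSrec` — binder row D1, (L4) bookkeeping: (c1) FOR THE ADOPTED TABLES — the first-order vertex of the wall's
# step propagator over `SrecAt`/`S0NAt` SPLITS as (pure field piece read through the field rows) + (an2's multiplier table `M1At` read
# through the multiplier rows)
# (β sub-cell, D1 formalisation swarm, unit `b2b-balaban-beta-d1-formalise-leaf-10`, gen 2; CLAIM «D1-L4-FOLD», part 5)

NOT IN PRINT; OUR BOOKKEEPING.  HONEST FRAMING (cell contract, verbatim): «discharging `BetaPertH` makes Bałaban's UV stability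
UNCONDITIONAL — a real constructive-QFT result; it is NOT the continuum limit and NOT the Clay problem.»  HONEST DEPENDENCY (verbatim):
«continuum YM on T⁴ ⇐ BetaPertH ∧ nine spine estimates (0/9 proved); BetaPertH ⇐ (D1) ∧ (D4) ∧ CAP+tail; G-an2-4 gates asym, D1 and
NE2/3/4.»  [folklore] kernel algebra; instantiates NO binder of the β-function wall; no `[cite:]`, no `def`, no `def … : Prop`; NOT D1,
NOT `BetaPertH`, NOT continuum, NOT Clay.

## What

For `G_j := coDressKBmAt (toSite r) Lc (KInvStep Lc j)` (in-block root `r`) and the ADOPTED first-order tables of the wall literal v2.26: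
* **`vertexOfK_SrecAt_succ_split`**: `vertexOfK G_{j+1} Lc (SrecAt d Lc (toSite r) cE cVH cΛ (j+1)) μ y
   = vertexOfK G_{j+1} Lc (κ u ↦ (cE·wE (j+1)) • e3OfK Lc G_j (SrecAt … j) κ u + (cVH·wVH (j+1)) • vhSAt (toSite r) d Lc rfl κ u) μ y
   + vertexOfM G_{j+1} Lc (M1At d Lc (toSite r) cΛ (j+1)) μ y`;
* **`vertexOfK_S0NAt_split`**: `vertexOfK G_0 Lc (S0NAt d Lc (toSite r) cE cVH cΛ) μ y
   = vertexOfK G_0 Lc (κ u ↦ cE • wilsonA d κ u + cVH • vhSAt (toSite r) d Lc rfl κ u) μ y + vertexOfM G_0 Lc (M1At d Lc (toSite r) cΛ 0) μ y`.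
I.e. an1's condition (c1) / an2's «ORDER-ONE CONSISTENCY» `dM G_j Lc (S_j^{pure}) (M1At … j) = vertexOfK G_j Lc (S_j)` holds LITERALLY for
the adopted `SrecAt`, with `S_j^{pure}` := the displayed E+vh lambda (the owner's forthcoming `SpureRecAt j` in NATIVE placement should be this
term by `rfl`; nothing is defined here).  Ingredients: part 4 (`LagrangeFoldLiteral`) for the Λ-summand, an1's `vertexOfK_add` for the
split (uniform entry bounds from the tables' `LocStencil` certificates).
-/

noncomputable section

open Finset
open scoped BigOperators
open Literature.MathematicalPhysics.QuantumFieldTheory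
open Literature.MathematicalPhysics.QuantumFieldTheory.Balaban1983to89
open Literature.MathematicalPhysics.QuantumFieldTheory.Balaban1983to89.Beta
open ExpKernelCalculus (MKer Decays VertexFamily Zl Zl_nonneg)
open KernelWard (bdd_of_biLoc)
open AffineAveraging (box toSite)
open OneStepResolventKernel (Fib LocStencil KInv decays_KInv decays_mono)
open OneStepKernelFamily (KInvStep vertexOfK decays_KInvStep)
open StepJetData (wilsonA wBound locStencil_wilsonA locStencil_add locStencil_smul)
open AveragingHessianKernels (ell)
open AveragingHessianKernelsRooted (vhSAt locStencil_vhSAt hessFFAt biLoc_hessFFAt)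
open InterLevelTransport (SLam locStencil_SLam)
open BalabanStepJets (lamCoeffOf abs_lamCoeffOf_le locStencil_mono)
open BalabanStepJetsSucc (lamCoeffK E2 wE wVH wΛ decays_E2 abs_lamCoeffK_le)
open SecondOrderResponse (vertexOfM dM)
open Summit.QuantumFields.BalabanUV.Beta.TameKernelCalculus
open Summit.QuantumFields.BalabanUV.Beta.ChartConjugationReflection (vertexOfK_add abs_le_of_locStencil)
open Summit.QuantumFields.BalabanUV.Beta.AxialDressingRooted (coDressKBmAt decays_coDressKBmAt_KInvStep one_le_of_neZero)
open Summit.QuantumFields.BalabanUV.Beta.SpineRooted (S0NAt M1At e3OfK locStencil_e3OfK)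
open Summit.QuantumFields.BalabanUV.Beta.WardLocusRecursive (SrecAt SrecAt_succ locStencil_SrecAt)
open Summit.QuantumFields.BalabanUV.Beta.LagrangeFoldLiteral (vertexOfK_lagrangePiece_literal_eq_M1At
  vertexOfK_lagrangePiece_literal_zero_eq_M1At)

namespace Summit.QuantumFields.BalabanUV.Beta.LagrangeFoldSrec

variable {d : ℕ} {Lc : ℕ} [NeZero Lc] {r : Fin (d + 1) → ℕ}

/-- [folklore] A uniform entry bound on `hessFFAt (toSite r) Lc` (from `biLoc_hessFFAt` at rate `0`). -/
theorem abs_hessFFAt_le (hr : r ∈ box (d + 1) Lc) (ρ' : Fin (d + 1)) (w : Fin (d + 1) → ℤ) (x z : Fin (d + 1) → ℤ) (a b : Fib d) :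
    |hessFFAt (toSite r) Lc ρ' w x z a b| ≤ 2 * (ell (d + 1) Lc : ℝ) ^ 2 * Real.exp (4 * ((d : ℝ) + 1) * Lc * 0) :=
  bdd_of_biLoc (biLoc_hessFFAt (one_le_of_neZero Lc) ρ' w hr le_rfl) le_rfl x z a b

/-- [folklore] **(c1) FOR `SrecAt (j+1)` AS ADOPTED**: the first-order vertex of `G_{j+1}` over the recursive table SPLITS as the vertex over
its E+vh piece plus the multiplier-column vertex over an2's `M1At d Lc (toSite r) cΛ (j+1)`. -/
theorem vertexOfK_SrecAt_succ_split (hr : r ∈ box (d + 1) Lc) (cE cVH cΛ : ℝ) (j : ℕ) (μ : Fin (d + 1)) (y : Fin (d + 1) → ℤ) :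
    vertexOfK (coDressKBmAt (toSite r) Lc (KInvStep (d := d) Lc (j + 1))) Lc (SrecAt d Lc (toSite r) cE cVH cΛ (j + 1)) μ y =
      vertexOfK (coDressKBmAt (toSite r) Lc (KInvStep (d := d) Lc (j + 1))) Lc
          (fun κ' u' => (cE * wE d Lc (j + 1)) • e3OfK Lc (coDressKBmAt (toSite r) Lc (KInvStep (d := d) Lc j))
              (SrecAt d Lc (toSite r) cE cVH cΛ j) κ' u' + (cVH * wVH d Lc (j + 1)) • vhSAt (toSite r) d Lc rfl κ' u') μ y
        + vertexOfM (coDressKBmAt (toSite r) Lc (KInvStep (d := d) Lc (j + 1))) Lc (M1At d Lc (toSite r) cΛ (j + 1)) μ y := by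
  have hLc : 1 ≤ Lc := one_le_of_neZero Lc
  -- the Λ-piece as a family
  set PΛ : Fin (d + 1) → (Fin (d + 1) → ℤ) → MKer (d + 1) (Fib d) := fun κ' u' =>
    (cΛ * wΛ d Lc (j + 1)) • SLam Lc (lamCoeffK (KInvStep (d := d) Lc (j + 1)) (E2 d Lc (j + 1)) Lc)
      (fun μ y => hessFFAt (toSite r) Lc μ y) κ' u' with hPΛ
  set P : Fin (d + 1) → (Fin (d + 1) → ℤ) → MKer (d + 1) (Fib d) := fun κ' u' =>
    (cE * wE d Lc (j + 1)) • e3OfK Lc (coDressKBmAt (toSite r) Lc (KInvStep (d := d) Lc j)) (SrecAt d Lc (toSite r) cE cVH cΛ j) κ' u' +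
      (cVH * wVH d Lc (j + 1)) • vhSAt (toSite r) d Lc rfl κ' u' with hP
  have e : SrecAt d Lc (toSite r) cE cVH cΛ (j + 1) = fun κ' u' => P κ' u' + PΛ κ' u' := by rw [SrecAt_succ]
  -- uniform entry bounds: both pieces are local stencil families
  obtain ⟨Cs, δs, hδs, hS⟩ := locStencil_SrecAt (d := d) hLc hr cE cVH cΛ j
  obtain ⟨C₁, δ₁, hδ₁, h1⟩ := locStencil_e3OfK (N := Lc) hLc (decays_coDressKBmAt_KInvStep (d := d) hr j) hS hδs
  have h2 : LocStencil (vhSAt (toSite r) d Lc rfl) (3 * (ell (d + 1) Lc : ℝ) ^ 2 * Real.exp (4 * ((d : ℝ) + 1) * Lc * δ₁)) δ₁ :=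
    locStencil_vhSAt hLc hr hδ₁.le
  have hPloc := locStencil_add (locStencil_smul (cE * wE d Lc (j + 1)) h1) (locStencil_smul (cVH * wVH d Lc (j + 1)) h2)
  obtain ⟨δA, CA, hδA, hCA, hA⟩ := decays_KInvStep (Lc := Lc) (d := d) (j + 1)
  obtain ⟨δE, CE, hδE, hCE, hE⟩ := decays_E2 (d := d) (Lc := Lc) (j + 1)
  set n : ℝ := min δA δE with hn
  have hn0 : 0 < n := lt_min hδA hδE
  have hA' : Decays (KInvStep (d := d) Lc (j + 1)) CA n := decays_mono hA hCA le_rfl (min_le_left _ _)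
  have hE' : Decays (E2 d Lc (j + 1)) CE n := decays_mono hE hCE le_rfl (min_le_right _ _)
  have hc := abs_lamCoeffK_le hA' hE' hn0 Lc
  have hn2 : (0 : ℝ) ≤ n / 2 := by positivity
  have hQ : VertexFamily (fun μ y => hessFFAt (toSite r) Lc μ y) Lc
      (2 * (ell (d + 1) Lc : ℝ) ^ 2 * Real.exp (4 * ((d : ℝ) + 1) * Lc * (n / 2))) (n / 2) :=
    fun μ y => biLoc_hessFFAt hLc μ y hr hn2
  have h3 := locStencil_SLam (N := Lc) hc hQ (by positivity)
    (mul_nonneg (mul_nonneg (Nat.cast_nonneg _) (mul_nonneg hCA hCE)) (Zl_nonneg (by linarith)))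
  have hΛloc := locStencil_smul (cΛ * wΛ d Lc (j + 1)) h3
  obtain ⟨BP, hPb⟩ : ∃ B : ℝ, ∀ κ' u x z a b, |P κ' u x z a b| ≤ B := ⟨_, abs_le_of_locStencil hPloc hδ₁.le⟩
  obtain ⟨BΛ, hΛb⟩ : ∃ B : ℝ, ∀ κ' u x z a b, |PΛ κ' u x z a b| ≤ B := ⟨_, abs_le_of_locStencil hΛloc (by positivity)⟩
  have hPb' : ∀ κ' u x z a b, |P κ' u x z a b| ≤ max BP BΛ := fun κ' u x z a b => (hPb κ' u x z a b).trans (le_max_left _ _)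
  have hΛb' : ∀ κ' u x z a b, |PΛ κ' u x z a b| ≤ max BP BΛ := fun κ' u x z a b => (hΛb κ' u x z a b).trans (le_max_right _ _)
  rw [e, vertexOfK_add (decays_coDressKBmAt_KInvStep (d := d) hr (j + 1)) hPb' hΛb']
  congr 1
  exact vertexOfK_lagrangePiece_literal_eq_M1At hr j cΛ (abs_hessFFAt_le hr) μ y

/-- [folklore] **(c1) FOR `S0NAt` AS ADOPTED** (level 0): the first-order vertex of `G_0` over the native level-0 table SPLITS as the vertex over
`cE • wilsonA + cVH • vhSAt` plus the multiplier-column vertex over `M1At d Lc (toSite r) cΛ 0`. -/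
theorem vertexOfK_S0NAt_split (hr : r ∈ box (d + 1) Lc) (cE cVH cΛ : ℝ) (μ : Fin (d + 1)) (y : Fin (d + 1) → ℤ) :
    vertexOfK (coDressKBmAt (toSite r) Lc (KInvStep (d := d) Lc 0)) Lc (S0NAt d Lc (toSite r) cE cVH cΛ) μ y =
      vertexOfK (coDressKBmAt (toSite r) Lc (KInvStep (d := d) Lc 0)) Lc
          (fun κ' u' => cE • wilsonA d κ' u' + cVH • vhSAt (toSite r) d Lc rfl κ' u') μ y
        + vertexOfM (coDressKBmAt (toSite r) Lc (KInvStep (d := d) Lc 0)) Lc (M1At d Lc (toSite r) cΛ 0) μ y := by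
  have hLc : 1 ≤ Lc := one_le_of_neZero Lc
  set PΛ : Fin (d + 1) → (Fin (d + 1) → ℤ) → MKer (d + 1) (Fib d) := fun κ' u' =>
    cΛ • SLam Lc (lamCoeffOf (KInv (N := Lc) (d := d)) Lc) (fun μ y => hessFFAt (toSite r) Lc μ y) κ' u' with hPΛ
  set P : Fin (d + 1) → (Fin (d + 1) → ℤ) → MKer (d + 1) (Fib d) := fun κ' u' =>
    cE • wilsonA d κ' u' + cVH • vhSAt (toSite r) d Lc rfl κ' u' with hP
  have e : S0NAt d Lc (toSite r) cE cVH cΛ = fun κ' u' => P κ' u' + PΛ κ' u' := rfl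
  obtain ⟨δ₀, C, hδ₀, hC, hdec⟩ := decays_KInv (N := Lc) (d := d)
  have hδ2 : (0 : ℝ) ≤ δ₀ / 2 := by positivity
  have h1 : LocStencil (wilsonA d) (wBound d * Real.exp (4 * (δ₀ / 2))) (δ₀ / 2) := locStencil_wilsonA hδ2
  have h2 : LocStencil (vhSAt (toSite r) d Lc rfl)
      (3 * (ell (d + 1) Lc : ℝ) ^ 2 * Real.exp (4 * ((d : ℝ) + 1) * Lc * (δ₀ / 2))) (δ₀ / 2) := locStencil_vhSAt hLc hr hδ2
  have hPloc := locStencil_add (locStencil_smul cE h1) (locStencil_smul cVH h2)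
  have hc := abs_lamCoeffOf_le (N := Lc) hdec hC hδ₀.le
  have hQ : VertexFamily (fun μ y => hessFFAt (toSite r) Lc μ y) Lc
      (2 * (ell (d + 1) Lc : ℝ) ^ 2 * Real.exp (4 * ((d : ℝ) + 1) * Lc * δ₀)) δ₀ :=
    fun μ y => biLoc_hessFFAt hLc μ y hr hδ₀.le
  have h3 := locStencil_SLam (N := Lc) hc hQ hδ₀ (mul_nonneg (mul_nonneg (by positivity) hC) (Real.exp_pos _).le)
  have hΛloc := locStencil_smul cΛ h3
  obtain ⟨BP, hPb⟩ : ∃ B : ℝ, ∀ κ' u x z a b, |P κ' u x z a b| ≤ B := ⟨_, abs_le_of_locStencil hPloc hδ2⟩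
  obtain ⟨BΛ, hΛb⟩ : ∃ B : ℝ, ∀ κ' u x z a b, |PΛ κ' u x z a b| ≤ B := ⟨_, abs_le_of_locStencil hΛloc (by positivity)⟩
  have hPb' : ∀ κ' u x z a b, |P κ' u x z a b| ≤ max BP BΛ := fun κ' u x z a b => (hPb κ' u x z a b).trans (le_max_left _ _)
  have hΛb' : ∀ κ' u x z a b, |PΛ κ' u x z a b| ≤ max BP BΛ := fun κ' u x z a b => (hΛb κ' u x z a b).trans (le_max_right _ _)
  rw [e, vertexOfK_add (decays_coDressKBmAt_KInvStep (d := d) hr 0) hPb' hΛb']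
  congr 1
  exact vertexOfK_lagrangePiece_literal_zero_eq_M1At hr cΛ (abs_hessFFAt_le hr) μ y

end Summit.QuantumFields.BalabanUV.Beta.LagrangeFoldSrec

end
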